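import Mathlib
import Summits.Ventures.PercRepro2.Defs
import Summits.Ventures.PercRepro2.Graph
import Summits.Ventures.PercRepro2.HullDefs
import Summits.Ventures.PercRepro2.Switching
import Summits.Ventures.PercRepro2.LastVertex
import Summits.Ventures.PercRepro2.ReimerIncreasing
import Summits.Ventures.PercRepro2.ReimerDecreasing
import Summits.Ventures.PercRepro2.TwoClusterBK
import Summits.Ventures.PercRepro2.OneSidedBase
import Summits.Ventures.PercRepro2.RigidOneSided

/-!
# The typed rigid one-sided permutation (blind cell PercRepro2, night-4 g6, 2026-08-24;
proofs/NIGHT4-G6.md §12)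

g5's rigid one-sided permutation (RO) (`RigidOS.exists_rigidOneSided`: on `{o ∈ C_R(u), h ∉ C_R(u)}`
every red edge inside `C_R(h)` can be flipped by a permutation of the class) in its TYPED form: the
principal condition `o ∈ C_R(u)` is replaced by `C_R(u) ∈ 𝓤` for an arbitrary up-set `𝓤` of vertex
sets (`exists_typedRigidOneSided`).  The proof is g5's: on the decreasing `{h ∉ C_R(u)}` the increasing
events `{C_R(u) ∈ 𝓤}` (witness: the `u`-component of the red set) and `{red_in(C_R(h)) ∈ 𝓕}`
(witness: the `h`-component) occur disjointly, so Reimer on a decreasing set (mine-1's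
`ReimerCube.reimer_decreasing`) bounds the count by `#{C_R(u) ∈ 𝓤, blue ∈ 𝓕, h ∉ C_R(u)}`, and Hall
turns the family of inequalities into the permutation.  With the typed (RS) (TypedRigidSide.lean)
these are the side ingredients of the cut-vertex composition of the typed rigid row.
-/

namespace Summit.Ventures.PercRepro2

namespace TypedRO

open Hull ReimerCube OneSided RigidOS

open scoped Classical

variable {V : Type*} {E : Type*} [Fintype E] [DecidableEq E] (ends : E → Sym2 V)

/-- The event `{C_R(u) ∈ 𝓤}` on the cube. -/
def evU (u : V) (𝓤 : Set (Set V)) (S : Finset E) : Prop := cluster ends (ofFinset S) u ∈ 𝓤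

omit [Fintype E] in
/-- `{C_R(u) ∈ 𝓤}` is increasing for an up-set `𝓤`. -/
lemma incr_evU (u : V) {𝓤 : Set (Set V)} (h𝓤 : IsUpperSet 𝓤) : Incr (evU ends u 𝓤) :=
  fun _ _ hST hS => h𝓤 (cluster_mono (ofFinset_mono hST) u) hS

omit [Fintype E] in
/-- The `u`-component of `S` carries the red cluster of `u`: every superset of it has a larger one. -/
lemma cluster_subset_of_sComp_subset (u : V) {S T : Finset E} (hT : sComp ends S u ⊆ T) :
    cluster ends (ofFinset S) u ⊆ cluster ends (ofFinset T) u := by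
  intro x hx
  have h1 : Carries ends S u x := hx
  exact ((carries_sComp h1).mono hT : Carries ends T u x)

/-- **Typed rigid one-sided domination, cube form**: for an up-set `𝓤` of vertex sets and an up-set
`𝓕` of edge sets, `#{C_R(u) ∈ 𝓤, red_in(C_R(h)) ∈ 𝓕, h ∉ C_R(u)} ≤ #{C_R(u) ∈ 𝓤, blue ∈ 𝓕, h ∉ C_R(u)}`. -/
theorem count_le_typedRigid (u h : V) {𝓤 : Set (Set V)} (h𝓤 : IsUpperSet 𝓤) {𝓕 : Set (Finset E)}
    (h𝓕 : IsUpperSet 𝓕) :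
    (Finset.univ.powerset.filter fun S : Finset E =>
        evU ends u 𝓤 S ∧ sComp ends S h ∈ 𝓕 ∧ ¬ Carries ends S u h).card ≤
      (Finset.univ.powerset.filter fun S : Finset E =>
        evU ends u 𝓤 S ∧ blueF (ofFinset S) ∈ 𝓕 ∧ ¬ Carries ends S u h).card := by
  calc (Finset.univ.powerset.filter fun S : Finset E =>
        evU ends u 𝓤 S ∧ sComp ends S h ∈ 𝓕 ∧ ¬ Carries ends S u h).card
      ≤ (Finset.univ.powerset.filter fun S : Finset E =>
          DOcc (evU ends u 𝓤) (evR ends h 𝓕) S ∧ evD ends u h S).card := by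
        apply Finset.card_le_card
        intro S hS
        simp only [Finset.mem_filter, Finset.mem_powerset] at hS ⊢
        obtain ⟨hSU, hAS, hJS, hDS⟩ := hS
        refine ⟨hSU, ⟨sComp ends S u, sComp ends S h, sComp_subset ends S u, sComp_subset ends S h,
          disjoint_sComp_of_not_carries hDS, ?_, ?_⟩, hDS⟩
        · intro T hT
          exact h𝓤 (cluster_subset_of_sComp_subset ends u hT) hAS
        · intro T hT
          exact h𝓕 (sComp_mono_of_subset ends h hT) hJS
    _ ≤ (Finset.univ.powerset.filter fun S : Finset E =>
          evU ends u 𝓤 S ∧ evR ends h 𝓕 (Finset.univ \ S) ∧ evD ends u h S).card :=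
        reimer_decreasing Finset.univ (evU ends u 𝓤) (evR ends h 𝓕) (evD ends u h)
          (incr_evU ends u h𝓤) (incr_evR ends h h𝓕) (decr_evD ends u h)
    _ ≤ _ := by
        apply Finset.card_le_card
        intro S hS
        simp only [Finset.mem_filter, Finset.mem_powerset, evR, evD] at hS ⊢
        obtain ⟨hSU, hAS, hJS, hDS⟩ := hS
        refine ⟨hSU, hAS, h𝓕 ?_ hJS, hDS⟩
        intro e he
        have := Finset.mem_sdiff.1 (sComp_subset ends _ h he)
        rw [RigidOS.mem_blueF, ofFinset_apply]
        simp [this.2]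

/-- The typed class `{C_R(u) ∈ 𝓤, h ∉ C_R(u)}`. -/
noncomputable def tClass (u h : V) (𝓤 : Set (Set V)) : Finset (Config E) :=
  Finset.univ.filter fun ζ => cluster ends ζ u ∈ 𝓤 ∧ h ∉ cluster ends ζ u

/-- **Typed rigid one-sided domination**: for every up-set `𝓕` of edge sets,
`#{ζ ∈ tClass : red_in(C_R(h)) ∈ 𝓕} ≤ #{ζ ∈ tClass : blue ζ ∈ 𝓕}`. -/
theorem card_typedRigid_le (u h : V) {𝓤 : Set (Set V)} (h𝓤 : IsUpperSet 𝓤) {𝓕 : Set (Finset E)}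
    (h𝓕 : IsUpperSet 𝓕) :
    ((tClass ends u h 𝓤).filter fun ζ => hRed ends h ζ ∈ 𝓕).card ≤
      ((tClass ends u h 𝓤).filter fun ζ => RigidOS.blueF ζ ∈ 𝓕).card := by
  rw [tClass, Finset.filter_filter, Finset.filter_filter, card_filter_eq_card_powerset_filter,
    card_filter_eq_card_powerset_filter]
  have key := count_le_typedRigid ends u h h𝓤 h𝓕
  refine le_of_le_of_eq (le_of_eq_of_le ?_ key) ?_
  · congr 1; ext S
    simp only [Finset.mem_filter, Finset.mem_powerset, mem_cluster, Carries, hRed, toFinset_ofFinset,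
      evU]
    tauto
  · congr 1; ext S
    simp only [Finset.mem_filter, Finset.mem_powerset, mem_cluster, Carries, evU]
    tauto

/-- **The typed rigid one-sided permutation** (Hall): for an up-set `𝓤` of vertex sets, an injection
of `{C_R(u) ∈ 𝓤, h ∉ C_R(u)}` into itself under which every red edge inside the red cluster of `h`
is blue in the image. -/
theorem exists_typedRigidOneSided (u h : V) {𝓤 : Set (Set V)} (h𝓤 : IsUpperSet 𝓤) :
    ∃ f : {ζ // ζ ∈ tClass ends u h 𝓤} → Config E, Function.Injective f ∧
      ∀ x, f x ∈ tClass ends u h 𝓤 ∧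
        ∀ e, e ∈ within ends (cluster ends x.1 h) → x.1 e = true → f x e = false := by
  let D := tClass ends u h 𝓤
  let R : Config E → Finset E := hRed ends h
  let t : {ζ // ζ ∈ D} → Finset (Config E) := fun x => D.filter fun η => ∀ e ∈ R x.1, η e = false
  have hall : ∀ s : Finset {ζ // ζ ∈ D}, s.card ≤ (s.biUnion t).card := by
    intro s
    obtain ⟨𝓕, h𝓕, h𝓕mem⟩ : ∃ 𝓕 : Set (Finset E), IsUpperSet 𝓕 ∧ ∀ F, F ∈ 𝓕 ↔ ∃ x ∈ s, R x.1 ⊆ F :=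
      ⟨{F | ∃ x ∈ s, R x.1 ⊆ F}, fun F F' hFF' ⟨x, hx, hxF⟩ => ⟨x, hx, hxF.trans hFF'⟩,
        fun F => Iff.rfl⟩
    have e1 : s.biUnion t = D.filter fun η => RigidOS.blueF η ∈ 𝓕 := by
      ext η
      simp only [Finset.mem_biUnion, Finset.mem_filter, t, h𝓕mem]
      constructor
      · rintro ⟨x, hx, hη, hsub⟩
        exact ⟨hη, x, hx, fun e he => RigidOS.mem_blueF.2 (hsub e he)⟩
      · rintro ⟨hη, x, hx, hsub⟩
        exact ⟨x, hx, hη, fun e he => RigidOS.mem_blueF.1 (hsub he)⟩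
    have e2 : s.card ≤ (D.filter fun ζ => R ζ ∈ 𝓕).card := by
      refine Finset.card_le_card_of_injOn (fun x => x.1) ?_ ?_
      · intro x hx
        rw [Finset.mem_coe] at hx
        simp only [Finset.mem_coe, Finset.mem_filter, h𝓕mem]
        exact ⟨x.2, x, hx, le_rfl⟩
      · intro x _ y _ hxy
        exact Subtype.ext hxy
    calc s.card ≤ (D.filter fun ζ => R ζ ∈ 𝓕).card := e2
      _ ≤ (D.filter fun ζ => RigidOS.blueF ζ ∈ 𝓕).card := card_typedRigid_le ends u h h𝓤 h𝓕
      _ = (s.biUnion t).card := by rw [e1]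
  obtain ⟨f, hf, hft⟩ := (Finset.all_card_le_biUnion_card_iff_exists_injective t).1 hall
  refine ⟨f, hf, fun x => ?_⟩
  have := hft x
  simp only [t, Finset.mem_filter] at this
  exact ⟨this.1, fun e he hred => this.2 e (mem_hRed_of ends he hred)⟩

end TypedRO

end Summit.Ventures.PercRepro2
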